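import Summits.CriticalPhenomena.Ising3DConformalLimit.Theses.ThresholdDilation
import Summits.CriticalPhenomena.Ising3DConformalLimit.Theorems.ExistsScaleCovariantLimit.Negative.PinnedForm
import HarnessLib

/-!
# The crux `ExistsScaleCovariantLimit` gives the dyadic scaling law of the axis two-point function
(crux item stmt-CriticalPhenomena-1981, line `Sketch` = `two-hierarchies-force-the-filter`,
glue stub `stub_dyadicScalingLaw_of_crux` (DL): crux ⟹ item stmt-CriticalPhenomena-6323,
the hinge `DyadicScalingLaw` of route `ThresholdDilation`)

Write `g(m) = ⟨σ₀σ_{m e₀}⟩_{β_c} = criticalTwoPoint 3 (Pi.single 0 m)` for the critical `ℤ³` Ising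
axis two-point function. The landed refutation criterion
`ExistsScaleCovariantLimitNegative.axis_ratio_tendsto` (PinnedForm) says: under the crux there is
`Δ ∈ [1/2, 3/4]` with `g(⌊s(k+1)⌋)/g(k+1) → s^{-2Δ}` for every real `s > 0` (axis regular
variation). Item 6323 asks for `Δ > 0` with `g(2n)·4^Δ/g(n) → 1` along the integers. Take the same
`Δ` (`Δ ≥ 1/2 > 0`) and `s = 2`: `⌊2(k+1)⌋ = 2(k+1)` (`Int.floor_natCast`), `2^{-2Δ}·4^Δ = 1`
(`Real.rpow_mul`, `Real.rpow_add`), so `g(2(k+1))·4^Δ/g(k+1) → 2^{-2Δ}·4^Δ = 1`, and the shift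
`n = k + 1` is removed by `Filter.tendsto_add_atTop_iff_nat`. No named facts beyond the landed
`axis_ratio_tendsto`. [folklore]
-/

noncomputable section

namespace Summit.CriticalPhenomena.Ising3DConformalLimit.Cruxes.ExistsScaleCovariantLimit.TwoHierarchies

open Literature.Probability.LatticeModels Filter Set
open scoped Topology

/-- The exponent bookkeeping `2^{-2Δ} · 4^Δ = 1` for real `Δ`. [folklore] -/
theorem two_rpow_neg_two_mul_mul_four_rpow (Δ : ℝ) :
    (2:ℝ) ^ (-(2:ℝ) * Δ) * (4:ℝ) ^ Δ = 1 := by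
  have h4 : (4:ℝ) = (2:ℝ) ^ (2:ℝ) := by rw [Real.rpow_two]; norm_num
  rw [h4, ← Real.rpow_mul (by norm_num : (0:ℝ) ≤ 2), ← Real.rpow_add (by norm_num : (0:ℝ) < 2),
    show -(2:ℝ) * Δ + 2 * Δ = 0 by ring, Real.rpow_zero]

/-- The floor of `2(k+1)`, computed in `ℝ`, is the natural number `2(k+1)`. [folklore] -/
theorem floor_two_mul_succ (k : ℕ) : ⌊(2:ℝ) * ((k:ℝ) + 1)⌋ = ((2 * (k + 1) : ℕ) : ℤ) := by
  have e : (2:ℝ) * ((k:ℝ) + 1) = ((2 * (k + 1) : ℕ) : ℝ) := by push_cast; ring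
  rw [e, Int.floor_natCast]

/-- **DL — glue: the crux gives route `ThresholdDilation`'s hinge, item stmt-CriticalPhenomena-6323
`DyadicScalingLaw`** (`∃ Δ > 0, g(2n)·4^Δ/g(n) → 1`, `g(m) = ⟨σ₀σ_{m e₀}⟩_{β_c}` on `ℤ³`): the landed
`ExistsScaleCovariantLimitNegative.axis_ratio_tendsto` gives `Δ ∈ [1/2, 3/4]` with
`g(⌊s(k+1)⌋)/g(k+1) → s^{-2Δ}` for every `s > 0`; take `s = 2`, use `⌊2(k+1)⌋ = 2(k+1)`, multiply by
`4^Δ = 2^{2Δ}` and reindex `n = k + 1`. [folklore] -/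
theorem stub_dyadicScalingLaw_of_crux :
    Summit.CriticalPhenomena.Ising3DConformalLimit.Theses.HyperoctahedralRP.ExistsScaleCovariantLimit →
    Summit.CriticalPhenomena.Ising3DConformalLimit.Theses.ThresholdDilation.DyadicScalingLaw := by
  intro h
  obtain ⟨Δ, hΔ, hax⟩ := ExistsScaleCovariantLimitNegative.axis_ratio_tendsto h
  have hΔpos : 0 < Δ := by linarith [hΔ.1]
  refine ⟨Δ, hΔpos, ?_⟩
  -- `g(⌊2(k+1)⌋)/g(k+1) · 4^Δ → 2^{-2Δ} · 4^Δ = 1`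
  have h3 := (hax 2 two_pos).mul_const ((4:ℝ) ^ Δ)
  rw [two_rpow_neg_two_mul_mul_four_rpow] at h3
  -- remove the shift `n = k + 1`
  refine (Filter.tendsto_add_atTop_iff_nat 1).1 ?_
  refine h3.congr fun k => ?_
  rw [floor_two_mul_succ, div_mul_eq_mul_div]

end Summit.CriticalPhenomena.Ising3DConformalLimit.Cruxes.ExistsScaleCovariantLimit.TwoHierarchies

end
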